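import Literature.Analysis.FluidPDE.SwirlMaximumPrinciple
import Literature.Analysis.FluidPDE.SelfSimilarCollapseAnsatz
import HarnessLib

/-!
# No sub-parabolic self-similar collapse with swirl, for any viscosity `ν ≥ 0`

Analysis/FluidPDE proof file (no definitions, no named facts, no `sorry`).  It assembles, as ONE
kernel theorem valid for the Navier–Stokes system with any viscosity `ν ≥ 0` — in particular for
the **Euler** system `ν = 0` — the exclusion of exactly self-similar axisymmetric collapse
`u(t, x) = (T − t)^{γ−1} U((T − t)^{−γ} x)` (`selfSimilarCollapse γ T U`, Constantin–Ignatova–Vicol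
2026 (3.2), Hou 2026 §1.1 with `γ = c_l`) carrying swirl when the length exponent is
sub-parabolic, `γ < ½`.  This is the remark of Hou 2026, §3 (p. 11 of the held text):

> "Due to the total circulation conservation, … we expect to have `c_l → 1/2`."

made precise: the swirl `Γ = r u^θ = x₀u₁ − x₁u₀` of the ansatz is
`Γ(t, x) = (T − t)^{2γ−1} Γ_U((T − t)^{−γ} x)` (`swirl_selfSimilarCollapse`), so for `γ < ½` and
`Γ_U(y₀) ≠ 0` it is unbounded as `t ↑ T` (`swirl_unbounded_of_lt_half`), while for a classical
axisymmetric solution with bounded velocity on each closed slab `[0, T'] × ℝ³`, `T' < T`, the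
maximum principle / conservation of circulation on material circles gives `|Γ(t, x)| ≤ sup |Γ₀|`
for every `ν ≥ 0` (`abs_swirl_le_of_classical_of_nonneg`; Majda–Bertozzi (2.67) for `ν = 0`,
Lei–Zhang 2017 (1.4) / KNSS 2009 (1.9) for `ν > 0`).  Hence the profile is swirl-free.

* `hasNoSwirl_profile_of_selfSimilarCollapse_of_lt_half` — the workhorse: hypotheses on the
  solution `v` (classical on every `[0, T']`, `0 < T' < T`, axisymmetric, bounded on each slab,
  `|Γ₀| ≤ M`, equal to the ansatz for `0 ≤ t < T`) and `γ < ½` ⇒ `HasNoSwirl U`;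
* `hasNoSwirl_profile_of_selfSimilarCollapse_of_lt_half_of_bounded` — the same with the
  hypotheses put on the PROFILE: `U` axisymmetric, `‖U‖ ≤ K`, `|Γ_U| ≤ M` (the velocity bound on
  `[0, T']` and the bound on `Γ₀` then follow from the ansatz);
* `hasNoSwirl_profile_of_selfSimilarEulerCollapse_of_lt_half` — the Euler case `ν = 0` by name;
* `IsAxisymmetric.selfSimilarCollapse` — the slices of the ansatz with an axisymmetric profile
  are axisymmetric.

Scope (what is NOT claimed): nothing about `γ ≥ ½` (there the swirl of the ansatz decays or is
stationary; the Type-I exclusion `isTypeIBlowup_selfSimilarCollapse` + KNSS is the relevant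
constraint), nothing about profiles without swirl, nothing about asymptotically / nearly
self-similar collapse (Hou's scenario is a DRIFTING `c_l(τ) → ½`, which this exact-ansatz theorem
does not exclude), and the circulation bound is used only for solutions whose velocity is
bounded on each closed slab before `T` and whose initial swirl is bounded.

## Mathlib / tree search

Tree: `selfSimilarCollapse`, `swirl_selfSimilarCollapse`, `swirl_unbounded_of_lt_half`,
`norm_selfSimilarCollapse_le` (`SelfSimilarCollapseAnsatz`); `abs_swirl_le_of_classical_of_nonneg`
(`SwirlMaximumPrinciple`); `IsAxisymmetric`, `swirl`, `HasNoSwirl`, `rotZ` (`AxisymmetricEuler`).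
Mathlib: `Ioo_mem_nhdsLT`, `Filter.Eventually.exists`, `Real.rpow_le_rpow_of_nonpos`.

## References

* T. Y. Hou, *A conservative finite-time blowup scenario for the 3D Navier–Stokes equations*
  (2026), §1.1 and §3 (p. 11 of the held text: total circulation conservation forces
  `c_l → 1/2`). [Hou2026]
* P. Constantin, M. Ignatova, V. Vicol, *On some properties of the curl operator and their
  consequences for the Navier–Stokes system* (2026), §3.1 eqs. (3.2)–(3.3).
  [ConstantinIgnatovaVicol2026Putative]
* A. J. Majda, A. L. Bertozzi, *Vorticity and Incompressible Flow*, CUP 2002, §2.3.3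
  eqs. (2.65)–(2.67). [MajdaBertozziCUP2002]
* Z. Lei, Q. S. Zhang, Pacific J. Math. 289 (2017), (1.4). [LeiZhang2017]
-/

noncomputable section

open Set Filter Topology

namespace Literature.Analysis.FluidPDE

section SwirlExclusion

variable {ν γ T : ℝ}
  {U : EuclideanSpace ℝ (Fin 3) → EuclideanSpace ℝ (Fin 3)}
  {v : ℝ → EuclideanSpace ℝ (Fin 3) → EuclideanSpace ℝ (Fin 3)}
  {q : ℝ → EuclideanSpace ℝ (Fin 3) → ℝ}

/-- Rotations about the axis commute with dilations: `R_θ (a y) = a R_θ y`. [folklore] -/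
private theorem rotZ_smul_eq (θ a : ℝ) (y : EuclideanSpace ℝ (Fin 3)) :
    rotZ θ (a • y) = a • rotZ θ y := by
  ext i
  fin_cases i <;> simp <;> ring

/-- **The slices of the self-similar ansatz with an axisymmetric profile are axisymmetric**:
rotations about the axis commute with the dilations `x ↦ (T−t)^{−γ} x` and the amplitude
`(T−t)^{γ−1}`. [cite: ConstantinIgnatovaVicol2026Putative, §3.1 eq. (3.2) (scaling consequence of the ansatz)] -/
theorem IsAxisymmetric.selfSimilarCollapse (hU : IsAxisymmetric U) (γ T t : ℝ) :
    IsAxisymmetric (selfSimilarCollapse γ T U t) := fun θ x => by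
  rw [selfSimilarCollapse_apply, selfSimilarCollapse_apply, ← rotZ_smul_eq, hU θ, ← rotZ_smul_eq]

/-- **No sub-parabolic self-similar collapse with swirl, any `ν ≥ 0`** (Hou 2026 §3: "Due to the
total circulation conservation … we expect to have `c_l → 1/2`"; SELFSIM-NOGO (M5)(b)).  Let
`ν ≥ 0`, `T > 0`, `γ < ½`, and let `(v, q)` be, on every closed slab `[0, T'] × ℝ³` with
`0 < T' < T`, a classical solution of the unforced system with viscosity `ν` (Euler if `ν = 0`),
with axisymmetric velocity bounded on each such slab and initial swirl `|Γ₀| ≤ M`.  If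
`v(t) = (T − t)^{γ−1} U((T − t)^{−γ} ·)` for `0 ≤ t < T`, then the profile carries no swirl,
`Γ_U ≡ 0`.  Proof: `Γ(t, x) = (T−t)^{2γ−1} Γ_U(y)` is unbounded near `T` at the points
`x = (T−t)^γ y₀` if `Γ_U(y₀) ≠ 0` (`swirl_unbounded_of_lt_half`), against `|Γ(t, x)| ≤ M`
(`abs_swirl_le_of_classical_of_nonneg` on `[0, t]`).
[cite: Hou2026, §3 p. 11 (total circulation conservation forces c_l → 1/2)] -/
theorem hasNoSwirl_profile_of_selfSimilarCollapse_of_lt_half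
    (hν : 0 ≤ ν) (hT : 0 < T) (hγ : γ < 1 / 2)
    (hcl : ∀ T' ∈ Ioo 0 T, IsClassicalNSSolutionOn (Icc 0 T') ν 0 v q)
    (haxi : ∀ t ∈ Ico 0 T, IsAxisymmetric (v t))
    (hV : ∀ T' ∈ Ioo 0 T, ∃ V : ℝ, ∀ t ∈ Icc 0 T', ∀ x, ‖v t x‖ ≤ V)
    {M : ℝ} (hM : ∀ x, |swirl (v 0) x| ≤ M)
    (hv : ∀ t ∈ Ico 0 T, v t = selfSimilarCollapse γ T U t) :
    HasNoSwirl U := by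
  intro y₀
  by_contra hy₀
  -- the swirl of the ansatz exceeds `M` somewhere, at times `t < T` close to `T`
  have hev := swirl_unbounded_of_lt_half (T := T) hγ hy₀ M
  obtain ⟨t, ⟨x, hx⟩, ht⟩ := (hev.and (Ioo_mem_nhdsLT hT)).exists
  -- but the maximum principle on `[0, t]` bounds it by `M`
  obtain ⟨V, hVt⟩ := hV t ht
  have hle := abs_swirl_le_of_classical_of_nonneg hν ht.1 (hcl t ht)
    (fun s hs => haxi s ⟨hs.1, hs.2.trans_lt ht.2⟩) hVt hM t ⟨ht.1.le, le_rfl⟩ x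
  rw [hv t ⟨ht.1.le, ht.2⟩] at hle
  exact (not_lt.mpr hle) hx

/-- **No sub-parabolic self-similar collapse with swirl — hypotheses on the profile** (Hou 2026
§3; SELFSIM-NOGO (M5)(b)).  Let `ν ≥ 0`, `T > 0`, `γ < ½`, and let the profile `U` be
axisymmetric and bounded, `‖U‖ ≤ K`, with bounded swirl `|Γ_U| ≤ M`.  If the ansatz
`v(t) = (T − t)^{γ−1} U((T − t)^{−γ} ·)` (`0 ≤ t < T`) is the velocity of a classical solution
`(v, q)` of the unforced system with viscosity `ν` on every `[0, T'] × ℝ³`, `0 < T' < T`, then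
`Γ_U ≡ 0`: the velocity is bounded by `K (T − T')^{γ−1}` on `[0, T']` (`norm_selfSimilarCollapse_le`)
and `|Γ₀| ≤ T^{2γ−1} M` (`swirl_selfSimilarCollapse`), so the previous theorem applies.
[cite: Hou2026, §3 p. 11 (total circulation conservation forces c_l → 1/2)] -/
theorem hasNoSwirl_profile_of_selfSimilarCollapse_of_lt_half_of_bounded
    (hν : 0 ≤ ν) (hT : 0 < T) (hγ : γ < 1 / 2)
    (hUaxi : IsAxisymmetric U) {K : ℝ} (hUK : ∀ y, ‖U y‖ ≤ K) {M : ℝ} (hUM : ∀ y, |swirl U y| ≤ M)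
    (hcl : ∀ T' ∈ Ioo 0 T, IsClassicalNSSolutionOn (Icc 0 T') ν 0 v q)
    (hv : ∀ t ∈ Ico 0 T, v t = selfSimilarCollapse γ T U t) :
    HasNoSwirl U := by
  have hK : 0 ≤ K := (norm_nonneg _).trans (hUK 0)
  refine hasNoSwirl_profile_of_selfSimilarCollapse_of_lt_half hν hT hγ hcl ?_ ?_
    (M := T ^ (2 * γ - 1) * M) ?_ hv
  · -- axisymmetric slices
    intro t ht
    rw [hv t ht]
    exact hUaxi.selfSimilarCollapse γ T t
  · -- velocity bound on `[0, T']`: `‖v t x‖ ≤ K (T−t)^{γ−1} ≤ K (T−T')^{γ−1}`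
    intro T' hT'
    refine ⟨K * (T - T') ^ (γ - 1), fun t ht x => ?_⟩
    have htT : t < T := ht.2.trans_lt hT'.2
    rw [hv t ⟨ht.1, htT⟩]
    refine (norm_selfSimilarCollapse_le htT hUK x).trans ?_
    refine mul_le_mul_of_nonneg_left ?_ hK
    exact Real.rpow_le_rpow_of_nonpos (sub_pos.mpr hT'.2) (by linarith [ht.2]) (by linarith)
  · -- initial swirl: `Γ₀(x) = T^{2γ−1} Γ_U(T^{−γ} x)`
    intro x
    rw [hv 0 ⟨le_rfl, hT⟩, swirl_selfSimilarCollapse hT, abs_mul, sub_zero,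
      abs_of_pos (Real.rpow_pos_of_pos hT _)]
    exact mul_le_mul_of_nonneg_left (hUM _) (Real.rpow_pos_of_pos hT _).le

/-- **No sub-parabolic self-similar EULER collapse with swirl** (`ν = 0`; Hou 2026 §3, the
"total circulation conservation" constraint `c_l ≥ ½` on a self-similar blow-up with swirl):
with `T > 0`, `γ < ½`, an axisymmetric bounded profile `U` with bounded swirl, if
`v(t) = (T − t)^{γ−1} U((T − t)^{−γ} ·)` (`0 ≤ t < T`) is the velocity of a classical solution of
the unforced Euler system (`IsClassicalNSSolutionOn (Icc 0 T') 0 0 v q`) on every `[0, T'] × ℝ³`,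
`0 < T' < T`, then `Γ_U ≡ 0`.
[cite: Hou2026, §3 p. 11 (total circulation conservation forces c_l → 1/2); MajdaBertozziCUP2002, §2.3.3 (2.65)–(2.67)] -/
theorem hasNoSwirl_profile_of_selfSimilarEulerCollapse_of_lt_half
    (hT : 0 < T) (hγ : γ < 1 / 2)
    (hUaxi : IsAxisymmetric U) {K : ℝ} (hUK : ∀ y, ‖U y‖ ≤ K) {M : ℝ} (hUM : ∀ y, |swirl U y| ≤ M)
    (hcl : ∀ T' ∈ Ioo 0 T, IsClassicalNSSolutionOn (Icc 0 T') 0 0 v q)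
    (hv : ∀ t ∈ Ico 0 T, v t = selfSimilarCollapse γ T U t) :
    HasNoSwirl U :=
  hasNoSwirl_profile_of_selfSimilarCollapse_of_lt_half_of_bounded le_rfl hT hγ hUaxi hUK hUM hcl hv

end SwirlExclusion

end Literature.Analysis.FluidPDE

end
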